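import Literature.AlgebraicGeometry.Motives.Varieties
import Mathlib.AlgebraicGeometry.Sites.Fpqc
import HarnessLib

/-!
# Morphisms of schemes descend along fpqc coverings ([GortzWedhorn2020] Thm. 14.72; [StacksProject] Tag 023Q)

Cell `hodgecm-mathlib` (D-0151), F-DAG F-10 (b2) «existence of the classifying map to `M/Γ`» (lead B-p02 (g13), sockets
2026-08-30 06:01:54Z / 06:47:50Z), brick (δ) (B-p13 (g19)): the LAST step of the descent — once the classifying map
`W → M → M/Γ` of a refined triple coequalises the kernel pair of the fpqc cover `c : W → T`, it factors UNIQUELY through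
`T`.  PROOF lane, theorems only (no definition, no named fact, no instance, no `sorry`).

Mathlib proves that a flat, surjective, quasi-compact morphism of schemes is an EFFECTIVE EPIMORPHISM (`Sites/Fpqc`:
`instance [QuasiCompact f] [Surjective f] [Flat f] : EffectiveEpi f`; [GortzWedhorn2020] Thm. 14.72 «morphisms of
schemes satisfy fpqc descent», [StacksProject] Tag 023Q).  This file packages it in the two shapes (b2) reads:

* `comp_eq_comp_of_kernelPair` — the descent condition on the KERNEL PAIR `W ×_T W ⇉ W` implies it for every pair
  `g₁, g₂ : Z → W` with `g₁ ≫ c = g₂ ≫ c` (factor through `pullback.lift`);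
* `existsUnique_desc_of_pullback_comp_eq` — **for `c : W → T` flat, surjective and quasi-compact and `h : W → Q` with
  `pr₁ ≫ h = pr₂ ≫ h` on `W ×_T W`, there is a UNIQUE `f : T → Q` with `c ≫ f = h`** (+ `desc_comp`/`eq_desc` readings);
* `hom_ext_of_fpqc` — `c` is an epimorphism: `c ≫ f₁ = c ≫ f₂ → f₁ = f₂`;
* `SchemeOver.existsUnique_desc_of_pullback_comp_eq` — the same for schemes OVER a base ring `k` (`SchemeOver k =
  Over (Spec k)`, e.g. `k = ℚ`): the descended morphism is automatically a `k`-morphism (`c` is an epimorphism), and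
  `SchemeOver.hom_ext_of_fpqc`.

HC_CM is proved only modulo the 7 printed citations until rung 0 closes; count-neutral F-DAG capital (consumer (b2)
`SiegelFineModuliSchemeQuotientClassify`).

## References
* [GortzWedhorn2020] U. Görtz, T. Wedhorn, *Algebraic Geometry I*, 2nd ed. (2020), Thm. 14.72 (fpqc descent of morphisms),
  Def. 14.69.
* [StacksProject] The Stacks project, Tag 023Q (Descent, Lemma 35.13.7: representable functors are fpqc sheaves).
-/

noncomputable section

universe u

open CategoryTheory CategoryTheory.Limits AlgebraicGeometry

namespace Literature.AlgebraicGeometry.Morphisms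

section Scheme

variable {W T Q : Scheme.{u}} (c : W ⟶ T)

/-- **The kernel pair tests the descent condition**: if `h : W → Q` satisfies `pr₁ ≫ h = pr₂ ≫ h` on `W ×_T W`, then
`g₁ ≫ h = g₂ ≫ h` for every pair `g₁, g₂ : Z → W` with `g₁ ≫ c = g₂ ≫ c` (the pair factors through `W ×_T W`).
[cite: GortzWedhorn2020, Def. 14.69 and Thm. 14.72] -/
theorem comp_eq_comp_of_kernelPair (h : W ⟶ Q) (hh : pullback.fst c c ≫ h = pullback.snd c c ≫ h) {Z : Scheme.{u}}
    (g₁ g₂ : Z ⟶ W) (hg : g₁ ≫ c = g₂ ≫ c) : g₁ ≫ h = g₂ ≫ h := by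
  rw [← pullback.lift_fst g₁ g₂ hg, Category.assoc, hh, ← Category.assoc, pullback.lift_snd]

/-- **fpqc DESCENT OF MORPHISMS** ([GortzWedhorn2020] Thm. 14.72; [StacksProject] Tag 023Q): for `c : W → T` flat,
surjective and quasi-compact (an fpqc covering) and `h : W → Q` coequalising the kernel pair of `c`
(`pr₁ ≫ h = pr₂ ≫ h` on `W ×_T W`), there is a UNIQUE `f : T → Q` with `c ≫ f = h`.  Mathlib: such a `c` is an effective
epimorphism (`Sites/Fpqc`), and `EffectiveEpi.desc`/`fac`/`uniq`. [cite: GortzWedhorn2020, Thm. 14.72]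
[cite: StacksProject, Tag 023Q (Descent, Lemma 35.13.7)] -/
theorem existsUnique_desc_of_pullback_comp_eq [Flat c] [Surjective c] [QuasiCompact c] (h : W ⟶ Q)
    (hh : pullback.fst c c ≫ h = pullback.snd c c ≫ h) : ∃! f : T ⟶ Q, c ≫ f = h := by
  have hdesc : ∀ {Z : Scheme.{u}} (g₁ g₂ : Z ⟶ W), g₁ ≫ c = g₂ ≫ c → g₁ ≫ h = g₂ ≫ h :=
    fun g₁ g₂ hg => comp_eq_comp_of_kernelPair c h hh g₁ g₂ hg
  refine ⟨EffectiveEpi.desc c h hdesc, EffectiveEpi.fac c h hdesc, fun f hf => ?_⟩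
  rw [← cancel_epi c, hf, EffectiveEpi.fac]

/-- **An fpqc covering is an epimorphism of schemes**: `c ≫ f₁ = c ≫ f₂ → f₁ = f₂`. [cite: GortzWedhorn2020, Thm. 14.72] -/
theorem hom_ext_of_fpqc [Flat c] [Surjective c] [QuasiCompact c] {f₁ f₂ : T ⟶ Q} (hf : c ≫ f₁ = c ≫ f₂) : f₁ = f₂ :=
  (cancel_epi c).mp hf

/-- Existence form with the factorisation named: `∃ f, c ≫ f = h`, and any two such agree. [cite: GortzWedhorn2020, Thm. 14.72] -/
theorem exists_desc_of_pullback_comp_eq [Flat c] [Surjective c] [QuasiCompact c] (h : W ⟶ Q)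
    (hh : pullback.fst c c ≫ h = pullback.snd c c ≫ h) : ∃ f : T ⟶ Q, c ≫ f = h :=
  (existsUnique_desc_of_pullback_comp_eq c h hh).exists

end Scheme

/-! ### Schemes over a base ring `k` (`SchemeOver k = Over (Spec k)`; the (b2) consumer takes `k = ℚ`) -/

section Over

variable {k : Type u} [CommRing k] {W T Q : Motives.SchemeOver k} (c : W ⟶ T)

/-- **fpqc descent of `k`-morphisms**: for a `k`-morphism `c : W → T` whose underlying morphism is flat, surjective and
quasi-compact and a `k`-morphism `h : W → Q` coequalising the kernel pair of `c` (on underlying schemes), there is a UNIQUE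
`k`-morphism `f : T → Q` with `c ≫ f = h` — the descended morphism of schemes is over `k` because `c` is an epimorphism
(`c ≫ f ≫ (Q → Spec k) = (W → Spec k) = c ≫ (T → Spec k)`). [cite: GortzWedhorn2020, Thm. 14.72]
[cite: StacksProject, Tag 023Q (Descent, Lemma 35.13.7)] -/
theorem SchemeOver.existsUnique_desc_of_pullback_comp_eq [Flat c.left] [Surjective c.left] [QuasiCompact c.left]
    (h : W ⟶ Q) (hh : pullback.fst c.left c.left ≫ h.left = pullback.snd c.left c.left ≫ h.left) :
    ∃! f : T ⟶ Q, c ≫ f = h := by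
  obtain ⟨f₀, hf₀, huniq⟩ := Literature.AlgebraicGeometry.Morphisms.existsUnique_desc_of_pullback_comp_eq c.left h.left hh
  -- the descended morphism is over `Spec k`
  have hover : f₀ ≫ Q.hom = T.hom := by
    rw [← cancel_epi c.left, reassoc_of% hf₀, Over.w h, Over.w c]
  refine ⟨Over.homMk f₀ hover, Over.OverMorphism.ext (by change c.left ≫ f₀ = h.left; exact hf₀), fun f hf => ?_⟩
  apply Over.OverMorphism.ext
  change f.left = f₀
  exact huniq f.left (by change c.left ≫ f.left = h.left; rw [← Over.comp_left, hf])

/-- **`k`-morphisms out of the target of an fpqc covering are determined after composing with it.**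
[cite: GortzWedhorn2020, Thm. 14.72] -/
theorem SchemeOver.hom_ext_of_fpqc [Flat c.left] [Surjective c.left] [QuasiCompact c.left] {f₁ f₂ : T ⟶ Q}
    (hf : c ≫ f₁ = c ≫ f₂) : f₁ = f₂ :=
  Over.OverMorphism.ext ((cancel_epi c.left).mp (by rw [← Over.comp_left, ← Over.comp_left, hf]))

/-- Existence form over `k`. [cite: GortzWedhorn2020, Thm. 14.72] -/
theorem SchemeOver.exists_desc_of_pullback_comp_eq [Flat c.left] [Surjective c.left] [QuasiCompact c.left]
    (h : W ⟶ Q) (hh : pullback.fst c.left c.left ≫ h.left = pullback.snd c.left c.left ≫ h.left) :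
    ∃ f : T ⟶ Q, c ≫ f = h :=
  (Literature.AlgebraicGeometry.Morphisms.SchemeOver.existsUnique_desc_of_pullback_comp_eq c h hh).exists

end Over

end Literature.AlgebraicGeometry.Morphisms

end
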